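import Summits.AtomisticToContinuum.FouriersLaw.Theses.HiddenChargeMazur
import Summits.AtomisticToContinuum.FouriersLaw.Theorems.EmbeddedDrudeMourreNessUnique
import Summits.AtomisticToContinuum.FouriersLaw.Theorems.OddSectorIrreversibilityCorrectorTheoryUniformMixing
import Literature.MathematicalPhysics.KineticTheory.LangevinChainNESSHolds

/-!
# Line `birth`, tightness note: `StaticKubo` FORCES an admissible Poisson solution at every parameter point

Crux workfile (`Cruxes/StaticKubo/Lines/birth_tightness.lean`, lead
`prover-line-stmt-AtomisticToContinuum-13510-0`, 2026-08-17).  Sorry-free.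

The hypotheses of the crux `HiddenChargeMazur.StaticKubo` (weak-NESS uniqueness, a steady-state family,
a response limit `D`) are all THEOREMS of the tree for `pinnedChain ω₂ lam β γ` with positive
parameters: uniqueness is `Theorems.nessUnique_proof` (EmbeddedDrudeMourre.NessUnique), existence is
`pinnedChain_exists_isSteadyState` (CEHR 2018 Thm 2.13, proved in the tree), and the response limit
exists by the open-chain Green–Kubo theorem `Corrector.openChainGreenKubo_holds`.  Hence
(`exists_admissible_of_staticKubo`) `StaticKubo` implies, for EVERY `ω₂, lam, β, γ, T > 0` and
`N ≥ 2`, the existence of a `C²` solution of `L_{T,T} F = -J` with the FULL growth clause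
`|F| + |∂_p F| + |∂_q F| ≤ C e^{θH}`, `θ < 1/(2T)` — i.e. the rev-1 stub `stub_poissonSolution`.
Combined with `Lines/birth_gradientBound_reduction.lean` (`exists_const_of_valueClass`: value-class
solutions differ by constants) this shows that the crux is EQUIVALENT, over the tree, to the weighted
gradient bound for the smooth Kubo corrector `u = ∫₀^∞ P_t J dt` (`Corrector.corrector_smooth`):
no line can close `StaticKubo` without that estimate, and with it the registered skeleton
(`Lines/birth.lean`, rev 3) closes at once.
-/

noncomputable section

open MeasureTheory Filter Topology
open Literature.MathematicalPhysics.KineticTheory.HeatConduction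

namespace Summit.AtomisticToContinuum.FouriersLaw.Cruxes.StaticKubo.Birth

/-- **`StaticKubo` forces an admissible Poisson solution at every parameter point.**  If the crux
`HiddenChargeMazur.StaticKubo` holds then for all `ω₂, lam, β, γ, T > 0` and `N ≥ 2` there is
`F ∈ C²(PhaseSpace N)` with `|F| + |∂_{p_i}F| + |∂_{q_i}F| ≤ C e^{θH}` (`θ < 1/(2T)`) solving
`generator N T T F = -Σ_i bondCurrent N i` pointwise: feed the crux the tree's weak-NESS uniqueness
(`nessUnique_proof`), a steady-state family chosen from `pinnedChain_exists_isSteadyState`, and the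
response limit supplied by `openChainGreenKubo_holds`. [folklore] -/
theorem exists_admissible_of_staticKubo
    (h : _root_.Summit.AtomisticToContinuum.FouriersLaw.Theses.HiddenChargeMazur.StaticKubo) :
    ∀ ω₂ lam β γ : ℝ, 0 < ω₂ → 0 < lam → 0 < β → 0 < γ → ∀ T : ℝ, 0 < T → ∀ N : ℕ, 2 ≤ N →
      ∃ F : PhaseSpace N → ℝ, ContDiff ℝ 2 F ∧
        (∃ C θ : ℝ, θ < 1 / (2 * T) ∧ ∀ (z : PhaseSpace N) (i : Fin N),
          |F z| + |partialP i F z| + |partialQ i F z| ≤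
            C * Real.exp (θ * (pinnedChain ω₂ lam β γ).hamiltonian N z)) ∧
        (∀ z : PhaseSpace N, (pinnedChain ω₂ lam β γ).generator N T T F z =
          -(∑ i : Fin N, (pinnedChain ω₂ lam β γ).bondCurrent N i z)) := by
  intro ω₂ lam β γ hω hl hβ hγ T hT N hN
  -- weak-NESS uniqueness (tree)
  have hU : ∀ (N : ℕ) (T_L T_R : ℝ), 0 < T_L → 0 < T_R →
      ∀ μ ν : Measure (PhaseSpace N), (pinnedChain ω₂ lam β γ).IsSteadyState N T_L T_R μ →
        (pinnedChain ω₂ lam β γ).IsSteadyState N T_L T_R ν → μ = ν :=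
    fun N T_L T_R hL hR μ ν hμ hν =>
      Summit.AtomisticToContinuum.FouriersLaw.Theorems.nessUnique_proof
        ω₂ lam β γ hω hl hβ hγ N T_L T_R hL hR μ ν hμ hν
  -- a steady-state family (tree: CEHR 2018 Thm 2.13, proved)
  classical
  let μf : (N : ℕ) → ℝ → ℝ → Measure (PhaseSpace N) := fun N T_L T_R =>
    if hLR : 0 < T_L ∧ 0 < T_R then
      Classical.choose (pinnedChain_exists_isSteadyState hω hl hβ hγ N hLR.1 hLR.2)
    else 0
  have hμf : ∀ (N : ℕ) (T_L T_R : ℝ), 0 < T_L → 0 < T_R →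
      (pinnedChain ω₂ lam β γ).IsSteadyState N T_L T_R (μf N T_L T_R) := by
    intro N T_L T_R hL hR
    have hLR : 0 < T_L ∧ 0 < T_R := ⟨hL, hR⟩
    simp only [μf, dif_pos hLR]
    exact Classical.choose_spec (pinnedChain_exists_isSteadyState hω hl hβ hγ N hLR.1 hLR.2)
  -- the response limit exists (tree: open-chain Green–Kubo)
  obtain ⟨-, hD⟩ :=
    Summit.AtomisticToContinuum.FouriersLaw.Theorems.OddSectorIrreversibility.Corrector.openChainGreenKubo_holds
      ω₂ lam β γ hω hl hβ hγ hU μf hμf T hT N hN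
  obtain ⟨F, hF2, hFg, hFL, -⟩ := h ω₂ lam β γ hω hl hβ hγ _ rfl hU μf hμf T hT N hN _ hD
  exact ⟨F, hF2, hFg, hFL⟩

end Summit.AtomisticToContinuum.FouriersLaw.Cruxes.StaticKubo.Birth

end
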